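import Mathlib
import HarnessLib
import Summits.CriticalPhenomena.CardyFormulaZ2.Theses.ModulusResponse
import Summits.CriticalPhenomena.CardyFormulaZ2.Theorems.ModulusResponseSmirnovResponseStubAnchorLimits
import Summits.CriticalPhenomena.CardyFormulaZ2.Theorems.ModulusResponseSmirnovResponseStubStretchedRectangle
import Summits.CriticalPhenomena.CardyFormulaZ2.Theorems.ModulusResponseSmirnovResponseStubRussoDefectForm

/-!
# Skeleton v2 (lead c2) for crux `SmirnovResponse` — route `ModulusResponse`, sub `CardyFormulaZ2`, line `registered`

Crux item `stmt-CriticalPhenomena-6468`, decl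
`Summit.CriticalPhenomena.CardyFormulaZ2.Theses.ModulusResponse.SmirnovResponse`
(FIRST-ORDER RESPONSE AT SMIRNOV'S POINT IS A STRETCH).

Reshape of the registered birth skeleton (sha 87a0ee15…: `stub_anchorLimits` + `stub_responseTight` +
`stub_clusterValue`), same composition idea (precompactness + identification of cluster values, glued by
`IsCompact.tendsto_nhds_of_unique_mapClusterPt` and `tendsto_nhds_limUnder`), with three changes that move
every provable-now piece out of the two open stubs:

* `stub_anchorLimits` is CLOSED (landed as `Theorems.stub_anchorLimits`, p146613) and is used by name.
* `stub_stretchedRectangle` (NEW; CLOSED, landed p148478): the stretches form a one-parameter group of plane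
  homeomorphisms, so `S_b R` is again a conformal rectangle `R'` with `S_a R' = S_{a+b} R` (carrier and
  arcs). With it, everything that quantifies over all `R` AND all pre-stretches `t` reduces to Smirnov's
  point `t₀ = -(log 3)/4` (`responseTight_of_anchor`, `clusterValue_of_anchor` below, sorry-free): the
  finite-mesh events of `(R, t)` and `(S_{t-t₀} R, t₀)` are the same sets.
* `stub_russoDefectForm` (NEW; CLOSED, landed — the finite-mesh backbone): for `δ > 0` the map
  `u ↦ μ_u[cross_δ S_t R]` has an honest right derivative at `u = 0`, equal to the DEFECT SUM
  `Σ_m (μ_0[flip_m ω ∈ A] − μ_0[A])`, `flip_m ω = ω Δ {v_m}`, `v_m = s(m − e₁, m)` (cells independent, cell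
  law affine in `u`: normal `(h,v) = (ω,ω)` w.p. `1-u`, defect `(h,v) = (ω, ¬ω)` w.p. `u`; only the finitely
  many cells whose down edge is an edge of the discrete domain contribute, so the `finsum` is a finite sum).
* the two OPEN stubs are restated on the `u = 0` model only (critical site percolation on the triangular
  cell lattice, equilateral at `t₀`) and about the defect sum: `stub_defectSumTight` (the marginality
  cancellation: the defect sums of `S_{t₀} R` stay bounded as `δ → 0⁺`) and `stub_defectSumClusterValue`
  (the stretch identification: ONE `k` with every cluster value of the defect sums equal to `k·L`,
  `L = P'(t₀)` for the honest limit function `P` of the stretched `u = 0` crossing probabilities).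

`SmirnovResponse_of` concludes the crux BY NAME; its only `sorry`s are inside the two OPEN `stub_*` theorems
(`stub_defectSumTight`, `stub_defectSumClusterValue`) — the research kernel of the crux at Smirnov's point.
-/

namespace Summit.CriticalPhenomena.CardyFormulaZ2.Cruxes.SmirnovResponse.Birth

open scoped Topology

/-- stub 1 (ANCHOR LIMITS) — CLOSED: landed as
`Summit.CriticalPhenomena.CardyFormulaZ2.Theorems.stub_anchorLimits` (p146613); kept here by name so that
the composition reads as registered. -/
theorem stub_anchorLimits :
    ∀ (μ : ℝ → MeasureTheory.Measure (Literature.Probability.Percolation.BondConfig (Literature.Probability.LatticeModels.Site 2))) (S : ℝ → ℂ → ℂ), (∀ u, μ u = MeasureTheory.Measure.map (fun p : Set (Literature.Probability.LatticeModels.Site 2) × Set (Literature.Probability.LatticeModels.Site 2) ↦ {e | ∃ m, (m ∈ p.1 ∧ e = s(m - Pi.single 0 1, m)) ∨ ((m ∈ p.1 ↔ m ∉ p.2) ∧ e = s(m - Pi.single 1 1, m))}) ((ProbabilityTheory.setBernoulli Set.univ Literature.Probability.Percolation.half).prod (ProbabilityTheory.setBernoulli Set.univ (Set.projIcc 0 1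 zero_le_one u)))) → (∀ t z, S t z = (Real.cosh t : ℂ) * z + Complex.I * (Real.sinh t : ℂ) * (starRingEnd ℂ) z) → ∀ (R : Literature.Probability.RandomPlanarGeometry.ConformalRectangle) (s : ℝ), ∃ P : ℝ, Filter.Tendsto (fun δ ↦ (μ 0).real (Literature.Probability.Percolation.discreteCrossing (S s '' R.carrier) δ (S s '' R.arc 0) (S s '' R.arc 2))) (nhdsWithin 0 (Set.Ioi 0)) (nhds P) :=
  Summit.CriticalPhenomena.CardyFormulaZ2.Theorems.stub_anchorLimits

/-- stub 2 (STRETCHED RECTANGLES) — CLOSED: landed as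
`Summit.CriticalPhenomena.CardyFormulaZ2.Theorems.stub_stretchedRectangle` (p148478): for the pinned stretches `S` (a one-parameter group of
plane homeomorphisms, `S_a ∘ S_b = S_{a+b}`), every conformal rectangle `R` and every `b`, there is a
conformal rectangle `R'` (= `S_b R` via `MarkedDomain.map`) with `S_a R' = S_{a+b} R` for all `a`, on the
carrier and on every boundary arc. -/
theorem stub_stretchedRectangle :
    ∀ (S : ℝ → ℂ → ℂ), (∀ t z, S t z = (Real.cosh t : ℂ) * z + Complex.I * (Real.sinh t : ℂ) * (starRingEnd ℂ) z) → ∀ (R : Literature.Probability.RandomPlanarGeometry.ConformalRectangle) (b : ℝ), ∃ R' : Literature.Probability.RandomPlanarGeometry.ConformalRectangle, ∀ a : ℝ, S a '' R'.carrier = S (a + b) '' R.carrier ∧ ∀ i, S a '' R'.arc i = S (a + b) '' R.arc i :=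
  Summit.CriticalPhenomena.CardyFormulaZ2.Theorems.stub_stretchedRectangle

/-- stub 3 (RUSSO DEFECT FORM = the finite-mesh backbone) — CLOSED: landed as
`Summit.CriticalPhenomena.CardyFormulaZ2.Theorems.stub_russoDefectForm` (worker 2): for the pinned `μ`, `S`, every
conformal rectangle `R`, pre-stretch `t` and mesh `δ > 0`, the map `u ↦ μ_u[cross_δ S_t R]` has, within
`[0, ∞)` at `u = 0`, the derivative `Σ_m (μ_0[flip_m ω ∈ cross] − μ_0[cross])` (a `finsum` with finite
support: flipping the down edge `v_m = s(m - e₁, m)` of a cell that is not an edge of the discrete domain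
does not change the event). Inputs: `stub_cellLaw` (μ_u = point-reflected corner model `M_{2u}`,
`prodBernoulli` with cell parameters affine in `u`), cylinder decomposition over the finitely many cells of
the discrete domain (`prodBernoulli_real_eq_sum_powerset`), product rule. -/
theorem stub_russoDefectForm :
    ∀ (μ : ℝ → MeasureTheory.Measure (Literature.Probability.Percolation.BondConfig (Literature.Probability.LatticeModels.Site 2))) (S : ℝ → ℂ → ℂ), (∀ u, μ u = MeasureTheory.Measure.map (fun p : Set (Literature.Probability.LatticeModels.Site 2) × Set (Literature.Probability.LatticeModels.Site 2) ↦ {e | ∃ m, (m ∈ p.1 ∧ e = s(m - Pi.single 0 1, m)) ∨ ((m ∈ p.1 ↔ m ∉ p.2) ∧ e = s(m - Pi.single 1 1, m))}) ((ProbabilityTheory.setBernoulli Set.univ Literature.Probability.Percolation.half).prod (ProbabilityTheory.setBernoulli Set.univ (Set.projIcc 0 1 zero_le_one u)))) → (∀ t z, S t z = (Real.cosh t : ℂ) * z + Complex.I * (Real.sinh t : ℂ) * (starRingEnd ℂ) z) → ∀ (R : Literature.Probability.RandomPlanarGeometry.ConformalRectangle) (t δ : ℝ), 0 < δ → HasDerivWithinAt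 (fun u ↦ (μ u).real (Literature.Probability.Percolation.discreteCrossing (S t '' R.carrier) δ (S t '' R.arc 0) (S t '' R.arc 2))) (finsum (fun m : Literature.Probability.LatticeModels.Site 2 ↦ (μ 0).real ((fun ω ↦ symmDiff ω {s(m - Pi.single 1 1, m)}) ⁻¹' Literature.Probability.Percolation.discreteCrossing (S t '' R.carrier) δ (S t '' R.arc 0) (S t '' R.arc 2)) - (μ 0).real (Literature.Probability.Percolation.discreteCrossing (S t '' R.carrier) δ (S t '' R.arc 0) (S t '' R.arc 2)))) (Set.Ici 0) 0 :=
  Summit.CriticalPhenomena.CardyFormulaZ2.Theorems.stub_russoDefectForm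

/-- stub 4 (DEFECT-SUM TIGHTNESS at Smirnov's point = the marginality cancellation, size L, OPEN): for
the pinned `μ`, `S` and every conformal rectangle `R`, the defect sums of the `u = 0` model for the
rectangle `S_{t₀} R`, `t₀ = -(log 3)/4`, stay bounded as `δ → 0⁺` (termwise `δ⁻²` cells × 4-arm
probability `δ^{5/4}`; the claim is the cancellation of the leading `δ^{-3/4}`). -/
theorem stub_defectSumTight :
    ∀ (μ : ℝ → MeasureTheory.Measure (Literature.Probability.Percolation.BondConfig (Literature.Probability.LatticeModels.Site 2))) (S : ℝ → ℂ → ℂ), (∀ u, μ u = MeasureTheory.Measure.map (fun p : Set (Literature.Probability.LatticeModels.Site 2) × Set (Literature.Probability.LatticeModels.Site 2) ↦ {e | ∃ m, (m ∈ p.1 ∧ e = s(m - Pi.single 0 1, m)) ∨ ((m ∈ p.1 ↔ m ∉ p.2) ∧ e = s(m - Pi.single 1 1, m))}) ((ProbabilityTheory.setBernoulli Set.univ Literature.Probability.Percolation.half).prod (ProbabilityTheory.setBernoulli Set.univ (Set.projIcc 0 1 zero_le_one u)))) → (∀ t z, S t z = (Real.cosh t : ℂ) * z + Complex.I * (Real.sinh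 t : ℂ) * (starRingEnd ℂ) z) → ∀ (R : Literature.Probability.RandomPlanarGeometry.ConformalRectangle), ∃ C : ℝ, ∀ᶠ δ in nhdsWithin (0 : ℝ) (Set.Ioi 0), |finsum (fun m : Literature.Probability.LatticeModels.Site 2 ↦ (μ 0).real ((fun ω ↦ symmDiff ω {s(m - Pi.single 1 1, m)}) ⁻¹' Literature.Probability.Percolation.discreteCrossing (S (-(Real.log 3) / 4) '' R.carrier) δ (S (-(Real.log 3) / 4) '' R.arc 0) (S (-(Real.log 3) / 4) '' R.arc 2)) - (μ 0).real (Literature.Probability.Percolation.discreteCrossing (S (-(Real.log 3) / 4) '' R.carrier) δ (S (-(Real.log 3) / 4) '' R.arc 0) (S (-(Real.log 3) / 4) '' R.arc 2)))| ≤ C := by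
  sorry

/-- stub 5 (DEFECT-SUM CLUSTER VALUES at Smirnov's point = the stretch identification, size L, OPEN):
for the pinned `μ`, `S` there is ONE constant `k` such that for every conformal rectangle `R`, every
honest limit function `P` of its stretched `u = 0` crossing probabilities with derivative `L` at
`t₀ = -(log 3)/4`, every cluster value `ρ` (as `δ → 0⁺`) of the defect sums of `S_{t₀} R` equals `k·L`. -/
theorem stub_defectSumClusterValue :
    ∀ (μ : ℝ → MeasureTheory.Measure (Literature.Probability.Percolation.BondConfig (Literature.Probability.LatticeModels.Site 2))) (S : ℝ → ℂ → ℂ), (∀ u, μ u = MeasureTheory.Measure.map (fun p : Set (Literature.Probability.LatticeModels.Site 2) × Set (Literature.Probability.LatticeModels.Site 2) ↦ {e | ∃ m, (m ∈ p.1 ∧ e = s(m - Pi.single 0 1, m)) ∨ ((m ∈ p.1 ↔ m ∉ p.2) ∧ e = s(m - Pi.single 1 1, m))}) ((ProbabilityTheory.setBernoulli Set.univ Literature.Probability.Percolation.half).prod (ProbabilityTheory.setBernoulli Set.univ (Set.projIcc 0 1 zero_le_one u)))) → (∀ t z, S t z = (Real.cosh t : ℂ) * z + Complex.I * (Real.sinh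 t : ℂ) * (starRingEnd ℂ) z) → ∃ k : ℝ, ∀ (R : Literature.Probability.RandomPlanarGeometry.ConformalRectangle) (P : ℝ → ℝ) (L ρ : ℝ), (∀ s : ℝ, Filter.Tendsto (fun δ ↦ (μ 0).real (Literature.Probability.Percolation.discreteCrossing (S s '' R.carrier) δ (S s '' R.arc 0) (S s '' R.arc 2))) (nhdsWithin 0 (Set.Ioi 0)) (nhds (P s))) → HasDerivAt P L (-(Real.log 3) / 4) → MapClusterPt ρ (nhdsWithin (0 : ℝ) (Set.Ioi 0)) (fun δ ↦ finsum (fun m : Literature.Probability.LatticeModels.Site 2 ↦ (μ 0).real ((fun ω ↦ symmDiff ω {s(m - Pi.single 1 1, m)}) ⁻¹' Literature.Probability.Percolation.discreteCrossing (S (-(Real.log 3) / 4) '' R.carrier) δ (S (-(Real.log 3) / 4) '' R.arc 0) (S (-(Real.log 3) / 4) '' R.arc 2)) - (μ 0).real (Literature.Probability.Percolation.discreteCrossing (S (-(Real.log 3) / 4) '' R.carrier) δ (S (-(Real.log 3) / 4) '' R.arc 0) (S (-(Real.log 3) / 4) '' R.arc 2)))) → ρ = k * L := by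
  sorry

/-! ### Sorry-free glue -/

/-- For `δ > 0` the finite-mesh right `u`-derivative IS the defect sum (stub 3 + uniqueness of one-sided
derivatives on `[0, ∞)`). -/
theorem derivWithin_eq_defectSum (μ : ℝ → MeasureTheory.Measure (Literature.Probability.Percolation.BondConfig (Literature.Probability.LatticeModels.Site 2))) (S : ℝ → ℂ → ℂ)
    (hμ : ∀ u, μ u = MeasureTheory.Measure.map (fun p : Set (Literature.Probability.LatticeModels.Site 2) × Set (Literature.Probability.LatticeModels.Site 2) ↦ {e | ∃ m, (m ∈ p.1 ∧ e = s(m - Pi.single 0 1, m)) ∨ ((m ∈ p.1 ↔ m ∉ p.2) ∧ e = s(m - Pi.single 1 1, m))}) ((ProbabilityTheory.setBernoulli Set.univ Literature.Probability.Percolation.half).prod (ProbabilityTheory.setBernoulli Set.univ (Set.projIcc 0 1 zero_le_one u))))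
    (hS : ∀ t z, S t z = (Real.cosh t : ℂ) * z + Complex.I * (Real.sinh t : ℂ) * (starRingEnd ℂ) z)
    (R : Literature.Probability.RandomPlanarGeometry.ConformalRectangle) (t : ℝ) {δ : ℝ} (hδ : 0 < δ) :
    derivWithin (fun u ↦ (μ u).real (Literature.Probability.Percolation.discreteCrossing (S t '' R.carrier) δ (S t '' R.arc 0) (S t '' R.arc 2))) (Set.Ici 0) 0 = finsum (fun m : Literature.Probability.LatticeModels.Site 2 ↦ (μ 0).real ((fun ω ↦ symmDiff ω {s(m - Pi.single 1 1, m)}) ⁻¹' Literature.Probability.Percolation.discreteCrossing (S t '' R.carrier) δ (S t '' R.arc 0) (S t '' R.arc 2)) - (μ 0).real (Literature.Probability.Percolation.discreteCrossing (S t '' R.carrier) δ (S t '' R.arc 0) (S t '' R.arc 2))) :=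
  (stub_russoDefectForm μ S hμ hS R t δ hδ).derivWithin (uniqueDiffWithinAt_Ici 0)

/-- The finite-mesh derivatives and the defect sums agree eventually along `δ → 0⁺`. -/
theorem derivWithin_eventuallyEq_defectSum (μ : ℝ → MeasureTheory.Measure (Literature.Probability.Percolation.BondConfig (Literature.Probability.LatticeModels.Site 2))) (S : ℝ → ℂ → ℂ)
    (hμ : ∀ u, μ u = MeasureTheory.Measure.map (fun p : Set (Literature.Probability.LatticeModels.Site 2) × Set (Literature.Probability.LatticeModels.Site 2) ↦ {e | ∃ m, (m ∈ p.1 ∧ e = s(m - Pi.single 0 1, m)) ∨ ((m ∈ p.1 ↔ m ∉ p.2) ∧ e = s(m - Pi.single 1 1, m))}) ((ProbabilityTheory.setBernoulli Set.univ Literature.Probability.Percolation.half).prod (ProbabilityTheory.setBernoulli Set.univ (Set.projIcc 0 1 zero_le_one u))))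
    (hS : ∀ t z, S t z = (Real.cosh t : ℂ) * z + Complex.I * (Real.sinh t : ℂ) * (starRingEnd ℂ) z)
    (R : Literature.Probability.RandomPlanarGeometry.ConformalRectangle) (t : ℝ) :
    (fun δ ↦ derivWithin (fun u ↦ (μ u).real (Literature.Probability.Percolation.discreteCrossing (S t '' R.carrier) δ (S t '' R.arc 0) (S t '' R.arc 2))) (Set.Ici 0) 0) =ᶠ[nhdsWithin (0 : ℝ) (Set.Ioi 0)] (fun δ ↦ finsum (fun m : Literature.Probability.LatticeModels.Site 2 ↦ (μ 0).real ((fun ω ↦ symmDiff ω {s(m - Pi.single 1 1, m)}) ⁻¹' Literature.Probability.Percolation.discreteCrossing (S t '' R.carrier) δ (S t '' R.arc 0) (S t '' R.arc 2)) - (μ 0).real (Literature.Probability.Percolation.discreteCrossing (S t '' R.carrier) δ (S t '' R.arc 0) (S t '' R.arc 2)))) :=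
  eventually_nhdsWithin_of_forall fun _ hδ ↦ derivWithin_eq_defectSum μ S hμ hS R t hδ

/-- RESPONSE TIGHTNESS at every pre-stretch (the registered `stub_responseTight` of the birth skeleton),
from stubs 2, 3, 4: `D_δ(R, t) = D_δ(S_{t-t₀} R, t₀)` literally, and at `t₀` the derivative is the
bounded defect sum. -/
theorem responseTight_of_anchor :
    ∀ (μ : ℝ → MeasureTheory.Measure (Literature.Probability.Percolation.BondConfig (Literature.Probability.LatticeModels.Site 2))) (S : ℝ → ℂ → ℂ), (∀ u, μ u = MeasureTheory.Measure.map (fun p : Set (Literature.Probability.LatticeModels.Site 2) × Set (Literature.Probability.LatticeModels.Site 2) ↦ {e | ∃ m, (m ∈ p.1 ∧ e = s(m - Pi.single 0 1, m)) ∨ ((m ∈ p.1 ↔ m ∉ p.2) ∧ e = s(m - Pi.single 1 1, m))}) ((ProbabilityTheory.setBernoulli Set.univ Literature.Probability.Percolation.half).prod (ProbabilityTheory.setBernoulli Set.univ (Set.projIcc 0 1 zero_le_one u)))) → (∀ t z, S t z = (Real.cosh t : ℂ) * z + Complex.I * (Real.sinh t : ℂ) * (starRingEnd ℂ) z) → ∀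 (R : Literature.Probability.RandomPlanarGeometry.ConformalRectangle) (t : ℝ), ∃ C : ℝ, ∀ᶠ δ in nhdsWithin (0 : ℝ) (Set.Ioi 0), |derivWithin (fun u ↦ (μ u).real (Literature.Probability.Percolation.discreteCrossing (S t '' R.carrier) δ (S t '' R.arc 0) (S t '' R.arc 2))) (Set.Ici 0) 0| ≤ C := by
  intro μ S hμ hS R t
  obtain ⟨R', hR'⟩ := stub_stretchedRectangle S hS R (t - (-(Real.log 3) / 4))
  obtain ⟨C, hC⟩ := stub_defectSumTight μ S hμ hS R'
  refine ⟨C, ?_⟩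
  have ht : -(Real.log 3) / 4 + (t - (-(Real.log 3) / 4)) = t := by ring
  have hev := derivWithin_eventuallyEq_defectSum μ S hμ hS R' (-(Real.log 3) / 4)
  rw [(hR' (-(Real.log 3) / 4)).1, (hR' (-(Real.log 3) / 4)).2 0, (hR' (-(Real.log 3) / 4)).2 2, ht] at hev hC
  filter_upwards [hev, hC] with δ hδ hCδ
  rw [hδ]
  exact hCδ

/-- CLUSTER-VALUE IDENTIFICATION at every pre-stretch (the registered `stub_clusterValue` of the birth
skeleton), from stubs 2, 3, 5: apply stub 5 to `R' = S_{t-t₀} R` and `P' s = P (s + (t - t₀))`; the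
finite-mesh events of `(R, t)` and `(R', t₀)` coincide and, eventually in `δ`, the derivative is the
defect sum, so cluster values transfer (`Filter.map_congr`). -/
theorem clusterValue_of_anchor :
    ∀ (μ : ℝ → MeasureTheory.Measure (Literature.Probability.Percolation.BondConfig (Literature.Probability.LatticeModels.Site 2))) (S : ℝ → ℂ → ℂ), (∀ u, μ u = MeasureTheory.Measure.map (fun p : Set (Literature.Probability.LatticeModels.Site 2) × Set (Literature.Probability.LatticeModels.Site 2) ↦ {e | ∃ m, (m ∈ p.1 ∧ e = s(m - Pi.single 0 1, m)) ∨ ((m ∈ p.1 ↔ m ∉ p.2) ∧ e = s(m - Pi.single 1 1, m))}) ((ProbabilityTheory.setBernoulli Set.univ Literature.Probability.Percolation.half).prod (ProbabilityTheory.setBernoulli Set.univ (Set.projIcc 0 1 zero_le_one u)))) → (∀ t z, S t z = (Real.cosh t : ℂ) * z + Complex.I * (Real.sinh t : ℂ) * (starRingEnd ℂ) z) → ∃ k : ℝ, ∀ (R : Literature.Probability.RandomPlanarGeometry.ConformalRectangle) (P : ℝ → ℝ) (t L ρ : ℝ), (∀ s : ℝ, Filter.Tendsto (fun δ ↦ (μ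 0).real (Literature.Probability.Percolation.discreteCrossing (S s '' R.carrier) δ (S s '' R.arc 0) (S s '' R.arc 2))) (nhdsWithin 0 (Set.Ioi 0)) (nhds (P s))) → HasDerivAt P L t → MapClusterPt ρ (nhdsWithin (0 : ℝ) (Set.Ioi 0)) (fun δ ↦ derivWithin (fun u ↦ (μ u).real (Literature.Probability.Percolation.discreteCrossing (S t '' R.carrier) δ (S t '' R.arc 0) (S t '' R.arc 2))) (Set.Ici 0) 0) → ρ = k * L := by
  intro μ S hμ hS
  obtain ⟨k, hk⟩ := stub_defectSumClusterValue μ S hμ hS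
  refine ⟨k, fun R P t L ρ hP hL hρ ↦ ?_⟩
  obtain ⟨R', hR'⟩ := stub_stretchedRectangle S hS R (t - (-(Real.log 3) / 4))
  have ht : -(Real.log 3) / 4 + (t - (-(Real.log 3) / 4)) = t := by ring
  refine hk R' (fun s ↦ P (s + (t - (-(Real.log 3) / 4)))) L ρ (fun s ↦ ?_) ?_ ?_
  · rw [(hR' s).1, (hR' s).2 0, (hR' s).2 2]
    exact hP _
  · have ht' : t = -(Real.log 3) / 4 + (t - (-(Real.log 3) / 4)) := by ring
    rw [ht'] at hL
    exact hL.comp_add_const _ _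
  · have hev := derivWithin_eventuallyEq_defectSum μ S hμ hS R' (-(Real.log 3) / 4)
    rw [(hR' (-(Real.log 3) / 4)).1, (hR' (-(Real.log 3) / 4)).2 0, (hR' (-(Real.log 3) / 4)).2 2, ht] at hev ⊢
    unfold MapClusterPt at hρ ⊢
    rwa [← Filter.map_congr hev]

/-- SKELETON: the crux `SmirnovResponse` BY NAME (real composition, no `sorry` of its own). Bounded real
nets with a unique cluster value converge (`IsCompact.tendsto_nhds_of_unique_mapClusterPt` on `[-C, C]`);
the `limUnder` of the crux is an honest limit by `stub_anchorLimits` and `tendsto_nhds_limUnder`. -/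
theorem SmirnovResponse_of :
    Summit.CriticalPhenomena.CardyFormulaZ2.Theses.ModulusResponse.SmirnovResponse := by
  intro μ S hμ hS
  -- the identification constant `k`, for the pinned data
  obtain ⟨k, hk⟩ := clusterValue_of_anchor μ S hμ hS
  refine ⟨k, fun R t L hL ↦ ?_⟩
  -- stub 1: the `limUnder` in the crux is an honest limit, for every stretch parameter `s`
  have hP : ∀ s : ℝ, Filter.Tendsto (fun δ ↦ (μ 0).real
      (Literature.Probability.Percolation.discreteCrossing (S s '' R.carrier) δ (S s '' R.arc 0)
        (S s '' R.arc 2))) (nhdsWithin 0 (Set.Ioi 0))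
      (nhds (Filter.limUnder (nhdsWithin (0 : ℝ) (Set.Ioi 0)) (fun δ ↦ (μ 0).real
        (Literature.Probability.Percolation.discreteCrossing (S s '' R.carrier) δ (S s '' R.arc 0)
          (S s '' R.arc 2))))) :=
    fun s ↦ tendsto_nhds_limUnder (stub_anchorLimits μ S hμ hS R s)
  -- tightness: the responses eventually lie in the compact interval `[-C, C]`
  obtain ⟨C, hC⟩ := responseTight_of_anchor μ S hμ hS R t
  have hmem : ∀ᶠ δ in nhdsWithin (0 : ℝ) (Set.Ioi 0),
      derivWithin (fun u ↦ (μ u).real (Literature.Probability.Percolation.discreteCrossing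
        (S t '' R.carrier) δ (S t '' R.arc 0) (S t '' R.arc 2))) (Set.Ici 0) 0 ∈ Set.Icc (-C) C :=
    hC.mono fun δ hδ ↦ Set.mem_Icc.mpr (abs_le.mp hδ)
  -- a bounded real net all of whose cluster values equal `k * L` converges to `k * L`
  refine (isCompact_Icc : IsCompact (Set.Icc (-C) C)).tendsto_nhds_of_unique_mapClusterPt hmem ?_
  intro ρ _ hρ
  exact hk R (fun s ↦ Filter.limUnder (nhdsWithin (0 : ℝ) (Set.Ioi 0)) (fun δ ↦ (μ 0).real
    (Literature.Probability.Percolation.discreteCrossing (S s '' R.carrier) δ (S s '' R.arc 0)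
      (S s '' R.arc 2)))) t L ρ hP hL hρ

end Summit.CriticalPhenomena.CardyFormulaZ2.Cruxes.SmirnovResponse.Birth
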